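import Literature.Analysis.FluidPDE.KNSSTypeIRate
import Literature.Analysis.FluidPDE.KNSSTypeIRateSelection
import Literature.Analysis.FluidPDE.KNSSTypeIRateRescaling
import HarnessLib

/-!
# KNSS 2009, Theorem 6.2: the main step reduced to the compactness–Liouville–vertex step
# (Steps 2–4 of the printed proof, assembled)

Analysis/FluidPDE proof file for the decomposition of
`Literature.Analysis.FluidPDE.KNSS2009_regularity_typeI_rate` (`KNSSTypeII`; Koch–Nadirashvili–
Seregin–Šverák, Acta Math. 203 (2009) = arXiv:0709.3599, Theorem 6.2) set up in `KNSSTypeIRate`.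
It proves

* `knss_rMulNorm_bounded_of_blowupSequence_unit` — for `ν = 1`: under the hypotheses of Theorem 6.2,
  if the compactness–Liouville–vertex step `KNSS2009_typeI_rate_blowupSequence` holds then
  `f = |x'| ‖u‖` is bounded on `(0, T) × ℝ³`. Proof = Steps 2–4 of the printed proof
  (arXiv pp. 12–13): assuming `f` unbounded, the blow-up sequence of `KNSSTypeIRateSelection`,
  the two rescalings `v⁽ᵏ⁾ = λ_k • stPull (λ_k²) λ_k T (a_k e₃) u`,
  `w⁽ᵏ⁾ = M_k⁻¹ • stPull (M_k⁻²) M_k⁻¹ s_k e₁ v⁽ᵏ⁾` (classical solutions by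
  `IsClassicalNSSolutionOn.nsRescale_translate_zero`) with the bounds of
  `KNSSTypeIRateRescaling`, and `‖w⁽ᵏ⁾(0, 0)‖ = 1` against `w⁽ᵏ⁾(0, 0) → 0`;
* `knss_rMulNorm_bounded_of_unit_viscosity` — the viscosity normalisation `ν ↦ 1`
  (`IsClassicalNSSolutionOn.viscosityRescale_set`), which maps the hypotheses of Theorem 6.2 to
  themselves with constants `C/√ν`, `C₂/ν`;
* `KNSS2009_typeI_rate_rMulNorm_bounded_of_blowupSequence :
    KNSS2009_typeI_rate_blowupSequence → KNSS2009_typeI_rate_rMulNorm_bounded`;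
* `KNSS2009_regularity_typeI_rate_of_blowupSequence :
    KNSS2009_regularity_bound_C_over_r → KNSS2009_typeI_rate_blowupSequence →
    KNSS2009_regularity_typeI_rate` — Theorem 6.2 as vendored rests exactly on Theorem 6.1 and
  on Steps 5–6 of its printed proof.

## References

* G. Koch, N. Nadirashvili, G. Seregin, V. Šverák, Acta Math. 203 (2009) 83–105 =
  arXiv:0709.3599, Theorem 6.2 and its proof, pp. 12–13. [KochNadirashviliSereginSverak2009]
-/

noncomputable section

open Set Function Filter
open _root_.Topology

namespace Literature.Analysis.FluidPDE

/-! ### Steps 2–4 assembled (`ν = 1`) -/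

section Unit

variable {T : ℝ} {u : ℝ → EuclideanSpace ℝ (Fin 3) → EuclideanSpace ℝ (Fin 3)}
  {p : ℝ → EuclideanSpace ℝ (Fin 3) → ℝ}

/-- `A_k = −t_k M_k² λ_k⁻² → −∞`: with `t_k ≥ T/2 > 0`, `M_k ≥ k + 1` and `0 < λ_k < R₀`,
`A_k ≤ −(T/(2R₀²))(k + 1)`. [folklore] -/
theorem knss_tendsto_A_atBot (hT : 0 < T) {R₀ : ℝ} (hR₀ : 0 < R₀) {t lam M : ℕ → ℝ}
    (ht : ∀ k, T / 2 ≤ t k) (hlam : ∀ k, 0 < lam k) (hlamR : ∀ k, lam k < R₀)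
    (hM : ∀ k : ℕ, (k : ℝ) + 1 ≤ M k) :
    Tendsto (fun k => -(t k * M k ^ 2 / lam k ^ 2)) atTop atBot := by
  have hc : 0 < T / 2 / R₀ ^ 2 := by positivity
  have hlin : Tendsto (fun k : ℕ => -(T / 2 / R₀ ^ 2 * ((k : ℝ) + 1))) atTop atBot :=
    tendsto_neg_atTop_atBot.comp
      ((tendsto_atTop_add_const_right _ _ tendsto_natCast_atTop_atTop).const_mul_atTop hc)
  refine tendsto_atBot_mono (fun k => ?_) hlin
  have hk1 : (1 : ℝ) ≤ (k : ℝ) + 1 := by simp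
  have hM1 : (k : ℝ) + 1 ≤ M k := hM k
  have hsq : ((k : ℝ) + 1) ≤ M k ^ 2 := by nlinarith
  have h1 : T / 2 * ((k : ℝ) + 1) ≤ t k * M k ^ 2 :=
    mul_le_mul (ht k) hsq (by positivity) (by linarith [ht k])
  have h2 : lam k ^ 2 ≤ R₀ ^ 2 := pow_le_pow_left₀ (hlam k).le (hlamR k).le 2
  have h0' : 0 ≤ t k * M k ^ 2 := le_trans (by positivity) h1
  have h3 : T / 2 * ((k : ℝ) + 1) / R₀ ^ 2 ≤ t k * M k ^ 2 / lam k ^ 2 :=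
    div_le_div₀ h0' h1 (pow_pos (hlam k) 2) h2
  have e : T / 2 / R₀ ^ 2 * ((k : ℝ) + 1) = T / 2 * ((k : ℝ) + 1) / R₀ ^ 2 := by ring
  rw [e]
  linarith

/-- **KNSS 2009, Theorem 6.2, main step from Steps 5–6, `ν = 1`.** Let `T > 0` and let
`(u, p)` be a classical solution of the unforced Navier–Stokes system (`ν = 1`) on
`ℝ³ × (0, T)`, bounded on the sub-slabs, with axisymmetric slices, (assumption1)
`√(T − t)‖u‖ ≤ C` (`C > 0`) and (assumption2) `|x'|‖u‖ ≤ C₂` for `|x'| ≥ R₀ > 0`. If the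
compactness–Liouville–vertex step `KNSS2009_typeI_rate_blowupSequence` holds, then
`f = |x'|‖u‖` is bounded on `(0, T) × ℝ³`. Proof (arXiv:0709.3599 pp. 12–13, Steps 2–4): if
not, `knss_exists_blowup_sequence` gives `t_k, a_k, λ_k, M_k`; the rescalings
`v⁽ᵏ⁾ = λ_k • stPull (λ_k²) λ_k T (a_k e₃) u` and `w⁽ᵏ⁾ = M_k⁻¹ • stPull (M_k⁻²) M_k⁻¹ s_k e₁ v⁽ᵏ⁾`,
`s_k = (t_k − T)λ_k⁻²`, are classical solutions on `(−Tλ_k⁻², 0)` and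
`(A_k, B_k) = (−t_kM_k²λ_k⁻², (T − t_k)M_k²λ_k⁻²)` (`IsClassicalNSSolutionOn.nsRescale_translate_zero`,
`knss_preimage_preimage_Ioo_eq`), `A_k → −∞`, and satisfy the symmetry and the bounds (wkbound),
(wkbound2), (wkbound3) with `K = C + 4` (`KNSSTypeIRateRescaling`); the fact gives
`w⁽ᵏ⁾(0, 0) → 0`, contradicting `‖w⁽ᵏ⁾(0, 0)‖ = M_k⁻¹ λ_k ‖u(t_k, a_k e₃ + λ_k e₁)‖ = 1`. [cite: KochNadirashviliSereginSverak2009, proof of Thm 6.2 (arXiv pp. 12–13)] -/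
theorem knss_rMulNorm_bounded_of_blowupSequence_unit (hd : KNSS2009_typeI_rate_blowupSequence)
    (hT : 0 < T) (h : IsClassicalNSSolutionOn (Ioo 0 T) 1 0 u p)
    (hbdd : ∀ T' < T, ∃ M : ℝ, ∀ t ∈ Ioo 0 T', ∀ x, ‖u t x‖ ≤ M)
    (haxi : ∀ t ∈ Ioo 0 T, IsAxisymmetric (u t))
    {C : ℝ} (hC : 0 < C) (hI : ∀ t ∈ Ioo 0 T, ∀ x, Real.sqrt (T - t) * ‖u t x‖ ≤ C)
    {C₂ R₀ : ℝ} (hR₀ : 0 < R₀)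
    (hdecay : ∀ t ∈ Ioo 0 T, ∀ x, R₀ ≤ cylRadius x → cylRadius x * ‖u t x‖ ≤ C₂) :
    ∃ C' : ℝ, ∀ t ∈ Ioo 0 T, ∀ x, cylRadius x * ‖u t x‖ ≤ C' := by
  by_contra hunb
  push Not at hunb
  obtain ⟨t, a, lam, M, hseq⟩ := knss_exists_blowup_sequence hT hbdd haxi hdecay hunb
  -- unpack the properties of the blow-up sequence
  have htk : ∀ k, t k ∈ Ioo 0 T := fun k => (hseq k).1
  have htk2 : ∀ k, T / 2 ≤ t k := fun k => (hseq k).2.1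
  have hlam : ∀ k, 0 < lam k := fun k => (hseq k).2.2.1
  have hlamR : ∀ k, lam k < R₀ := fun k => (hseq k).2.2.2.1
  have hMk : ∀ k : ℕ, (k : ℝ) + 1 ≤ M k := fun k => (hseq k).2.2.2.2.1
  have hval : ∀ k, lam k * ‖u (t k) (EuclideanSpace.single 2 (a k) +
      lam k • EuclideanSpace.single 0 1)‖ = M k := fun k => (hseq k).2.2.2.2.2.1
  have hmax : ∀ k, ∀ τ ∈ Ioc 0 (t k), ∀ y, cylRadius y * ‖u τ y‖ ≤ 2 * M k :=
    fun k => (hseq k).2.2.2.2.2.2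
  have hMpos : ∀ k, 0 < M k := fun k => by
    have := hMk k
    have : (0 : ℝ) ≤ k := Nat.cast_nonneg k
    linarith
  have h0 : ∀ k, (EuclideanSpace.single 2 (a k) : EuclideanSpace ℝ (Fin 3)) 0 = 0 :=
    fun k => by simp
  have h1 : ∀ k, (EuclideanSpace.single 2 (a k) : EuclideanSpace ℝ (Fin 3)) 1 = 0 :=
    fun k => by simp
  -- the rescaled classical solutions
  have hv : ∀ k, IsClassicalNSSolutionOn ((fun r => T + lam k ^ 2 * r) ⁻¹' Ioo 0 T) 1 0
      (lam k • stPull (lam k ^ 2) (lam k) T (EuclideanSpace.single 2 (a k)) u)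
      (lam k ^ 2 • stPull (lam k ^ 2) (lam k) T (EuclideanSpace.single 2 (a k)) p) :=
    fun k => h.nsRescale_translate_zero (hlam k) T _
  have hw : ∀ k, IsClassicalNSSolutionOn
      (Ioo (-(t k * M k ^ 2 / lam k ^ 2)) ((T - t k) * M k ^ 2 / lam k ^ 2)) 1 0
      ((M k)⁻¹ • stPull ((M k)⁻¹ ^ 2) (M k)⁻¹ ((t k - T) / lam k ^ 2) (EuclideanSpace.single 0 1)
        (lam k • stPull (lam k ^ 2) (lam k) T (EuclideanSpace.single 2 (a k)) u))
      ((M k)⁻¹ ^ 2 • stPull ((M k)⁻¹ ^ 2) (M k)⁻¹ ((t k - T) / lam k ^ 2)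
        (EuclideanSpace.single 0 1)
        (lam k ^ 2 • stPull (lam k ^ 2) (lam k) T (EuclideanSpace.single 2 (a k)) p)) := by
    intro k
    have := (hv k).nsRescale_translate_zero (inv_pos.2 (hMpos k)) ((t k - T) / lam k ^ 2)
      (EuclideanSpace.single 0 1)
    rwa [knss_preimage_preimage_Ioo_eq (hlam k) (hMpos k)] at this
  -- the limits
  have hMlim : Tendsto M atTop atTop :=
    tendsto_atTop_mono hMk (tendsto_atTop_add_const_right _ _ tendsto_natCast_atTop_atTop)
  have hAlim : Tendsto (fun k => -(t k * M k ^ 2 / lam k ^ 2)) atTop atBot :=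
    knss_tendsto_A_atBot hT hR₀ htk2 hlam hlamR hMk
  have hBpos : ∀ k, 0 < (T - t k) * M k ^ 2 / lam k ^ 2 := fun k => by
    have := (htk k).2
    have := hMpos k
    have := hlam k
    exact div_pos (mul_pos (by linarith) (by positivity)) (by positivity)
  have hK : 0 < C + 4 := by linarith
  -- apply the fact
  have hlim := hd hC hK hMpos hMlim hAlim hBpos hw ?_ ?_ ?_ ?_ ?_
  · -- the contradiction with `‖w k 0 0‖ = 1`
    have hone : ∀ k, ‖((M k)⁻¹ • stPull ((M k)⁻¹ ^ 2) (M k)⁻¹ ((t k - T) / lam k ^ 2)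
        (EuclideanSpace.single 0 1)
        (lam k • stPull (lam k ^ 2) (lam k) T (EuclideanSpace.single 2 (a k)) u)) 0 0‖ = 1 := by
      intro k
      rw [knssW_norm_zero_zero (hMpos k),
        knssV_norm_single (hlam k).le (knss_add_sq_mul_s₀ (hlam k).ne'), hval k,
        inv_mul_cancel₀ (hMpos k).ne']
    have hnorm := hlim.norm
    rw [norm_zero] at hnorm
    have heq : (fun k => ‖((M k)⁻¹ • stPull ((M k)⁻¹ ^ 2) (M k)⁻¹ ((t k - T) / lam k ^ 2)
        (EuclideanSpace.single 0 1)
        (lam k • stPull (lam k ^ 2) (lam k) T (EuclideanSpace.single 2 (a k)) u)) 0 0‖) =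
        fun _ => (1 : ℝ) := funext hone
    rw [heq] at hnorm
    exact one_ne_zero (tendsto_nhds_unique tendsto_const_nhds hnorm)
  · -- per-`k` bound on `(A_k, 0]`
    intro k
    have hT' : (t k + T) / 2 < T := by linarith [(htk k).2]
    obtain ⟨Mb, hMb⟩ := hbdd _ hT'
    refine ⟨(M k)⁻¹ * (lam k * Mb), fun τ hτ x => knssW_norm_le (hMpos k) (fun y => ?_) x⟩
    refine knssV_norm_le (hlam k).le (fun z => hMb _ ?_ z) y
    have hs := knss_mem_Ioc_time (T := T) (hlam k) (hMpos k) hτ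
    exact ⟨hs.1, by linarith [hs.2, (htk k).2]⟩
  · -- axisymmetry about the axis through `-M_k e₁`
    intro k τ hτ θ x
    refine knssW_axisymmetric_about (hMpos k).ne' ?_ θ x
    exact isAxisymmetric_smul_stPull_of_axis (h0 k) (h1 k)
      (haxi _ (knss_mem_Ioo_time (hlam k) (hMpos k) hτ))
  · -- (wkbound3)
    intro k τ hτ x
    refine knssW_sqrt_neg_mul_norm_le (hMpos k) (knss_s₀_nonpos (htk k).2.le) (fun y => ?_) x
    refine knssV_sqrt_neg_mul_norm_le (hlam k) hI ?_ y
    exact knss_mem_Ioo_time (hlam k) (hMpos k) ⟨hτ.1, lt_of_lt_of_le hτ.2 (hBpos k).le⟩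
  · -- (wkbound), with `4 ≤ C + 4`
    intro k τ hτ x hx
    refine (knssW_norm_le_four_of_cylRadius (hMpos k) (fun y => ?_) hx).trans (by linarith)
    exact knssV_cylRadius_mul_norm_le (h0 k) (h1 k) (hlam k) (hmax k)
      (knss_mem_Ioc_time (hlam k) (hMpos k) hτ) y
  · -- (wkbound2), with `(C + 2) M ≤ (C + 4) M`
    intro k τ hτ x
    refine (knssW_norm_mul_le (C := C) (hMpos k) (knss_s₀_nonpos (htk k).2.le) (fun y => ?_)
      (fun y => ?_) x).trans ?_
    · refine knssV_sqrt_neg_mul_norm_le (hlam k) hI ?_ y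
      have hs := knss_mem_Ioc_time (T := T) (hlam k) (hMpos k) hτ
      exact ⟨hs.1, lt_of_le_of_lt hs.2 (htk k).2⟩
    · exact knssV_cylRadius_mul_norm_le (h0 k) (h1 k) (hlam k) (hmax k)
        (knss_mem_Ioc_time (hlam k) (hMpos k) hτ) y
    · have := hMpos k
      nlinarith

end Unit

/-! ### The viscosity normalisation and the assembled reductions -/

section Viscosity

/-- **Viscosity normalisation of the main step.** If the main step of Theorem 6.2 holds for
`ν = 1` (in the form: classical on `(0, T)`, bounded on sub-slabs, axisymmetric,
`√(T − t)‖u‖ ≤ C` with `C > 0`, `|x'|‖u‖ ≤ C₂` for `|x'| ≥ R₀ > 0` ⇒ `|x'|‖u‖` bounded), then it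
holds for every `ν > 0`: `ũ(s, x) = ν⁻¹u(s/ν, x)` is a classical solution with `ν = 1` on
`(0, νT)` (`IsClassicalNSSolutionOn.viscosityRescale_set`) satisfying the hypotheses with
`C/√ν ⊔ 1`, `C₂/ν`, and `|x'|‖u(t, x)‖ = ν |x'|‖ũ(νt, x)‖` (KNSS normalise `ν = 1`). [cite: KochNadirashviliSereginSverak2009, §1 (1.1) (ν = 1) and Thm 6.2] -/
theorem knss_rMulNorm_bounded_of_unit_viscosity
    (H : ∀ ⦃T : ℝ⦄ ⦃u : ℝ → EuclideanSpace ℝ (Fin 3) → EuclideanSpace ℝ (Fin 3)⦄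
      ⦃p : ℝ → EuclideanSpace ℝ (Fin 3) → ℝ⦄, 0 < T →
      IsClassicalNSSolutionOn (Ioo 0 T) 1 0 u p →
      (∀ T' < T, ∃ M : ℝ, ∀ t ∈ Ioo 0 T', ∀ x, ‖u t x‖ ≤ M) →
      (∀ t ∈ Ioo 0 T, IsAxisymmetric (u t)) →
      (∀ ⦃C : ℝ⦄, 0 < C → (∀ t ∈ Ioo 0 T, ∀ x, Real.sqrt (T - t) * ‖u t x‖ ≤ C) →
        ∀ ⦃C₂ R₀ : ℝ⦄, 0 < R₀ →
          (∀ t ∈ Ioo 0 T, ∀ x, R₀ ≤ cylRadius x → cylRadius x * ‖u t x‖ ≤ C₂) →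
          ∃ C' : ℝ, ∀ t ∈ Ioo 0 T, ∀ x, cylRadius x * ‖u t x‖ ≤ C')) :
    KNSS2009_typeI_rate_rMulNorm_bounded := by
  intro ν T u p hν hT h hbdd haxi hrate hdecay
  obtain ⟨C, hC⟩ := hrate
  obtain ⟨C₂, R₀, hR₀, hC₂⟩ := hdecay
  -- the rescaled solution with unit viscosity on `(0, νT)`
  have hmaps : MapsTo (fun s => ν⁻¹ * s) (Ioo 0 (ν * T)) (Ioo 0 T) :=
    fun s hs => (inv_mul_mem_Ioo_iff hν).2 hs
  have h1 : IsClassicalNSSolutionOn (Ioo 0 (ν * T)) 1 0 (timeRescale ν⁻¹ ν⁻¹ u)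
      (timeRescale ν⁻¹ (ν⁻¹ ^ 2) p) := by
    simpa using h.viscosityRescale_set hν.ne' hmaps isOpen_Ioo.uniqueDiffOn
  have hνT : 0 < ν * T := mul_pos hν hT
  have hinv : 0 ≤ ν⁻¹ := inv_nonneg.2 hν.le
  -- hypotheses of the unit-viscosity statement
  have hbdd1 : ∀ T' < ν * T, ∃ M : ℝ, ∀ s ∈ Ioo 0 T', ∀ x, ‖timeRescale ν⁻¹ ν⁻¹ u s x‖ ≤ M := by
    intro T' hT'
    have hT'' : ν⁻¹ * T' < T := by
      calc ν⁻¹ * T' < ν⁻¹ * (ν * T) := mul_lt_mul_of_pos_left hT' (inv_pos.2 hν)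
        _ = T := by field_simp
    obtain ⟨M, hM⟩ := hbdd _ hT''
    refine ⟨ν⁻¹ * M, fun s hs x => ?_⟩
    rw [timeRescale_apply, norm_smul, Real.norm_of_nonneg hinv]
    refine mul_le_mul_of_nonneg_left (hM _ ⟨?_, ?_⟩ x) hinv
    · exact mul_pos (inv_pos.2 hν) hs.1
    · exact mul_lt_mul_of_pos_left hs.2 (inv_pos.2 hν)
  have haxi1 : ∀ s ∈ Ioo 0 (ν * T), IsAxisymmetric (timeRescale ν⁻¹ ν⁻¹ u s) := by
    intro s hs θ x
    rw [timeRescale_slice]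
    simp only [(haxi _ (hmaps hs)) θ x, SereginSverak2009.rotZ_smul_vec]
  have hC' : 0 < max (C / Real.sqrt ν) 1 := lt_of_lt_of_le one_pos (le_max_right _ _)
  have hrate1 : ∀ s ∈ Ioo 0 (ν * T), ∀ x,
      Real.sqrt (ν * T - s) * ‖timeRescale ν⁻¹ ν⁻¹ u s x‖ ≤ max (C / Real.sqrt ν) 1 := by
    intro s hs x
    have ht : ν⁻¹ * s ∈ Ioo 0 T := hmaps hs
    have key := hC _ ht x
    have hsν : 0 < Real.sqrt ν := Real.sqrt_pos.2 hν
    rw [timeRescale_apply, norm_smul, Real.norm_of_nonneg hinv]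
    have e : ν * T - s = ν * (T - ν⁻¹ * s) := by field_simp
    rw [e, Real.sqrt_mul hν.le]
    refine le_trans ?_ (le_max_left _ _)
    rw [le_div_iff₀ hsν]
    calc Real.sqrt ν * Real.sqrt (T - ν⁻¹ * s) * (ν⁻¹ * ‖u (ν⁻¹ * s) x‖) * Real.sqrt ν
        = (Real.sqrt ν * Real.sqrt ν * ν⁻¹) * (Real.sqrt (T - ν⁻¹ * s) * ‖u (ν⁻¹ * s) x‖) := by
          ring
      _ = Real.sqrt (T - ν⁻¹ * s) * ‖u (ν⁻¹ * s) x‖ := by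
          rw [Real.mul_self_sqrt hν.le, mul_inv_cancel₀ hν.ne', one_mul]
      _ ≤ C := key
  have hdecay1 : ∀ s ∈ Ioo 0 (ν * T), ∀ x, R₀ ≤ cylRadius x →
      cylRadius x * ‖timeRescale ν⁻¹ ν⁻¹ u s x‖ ≤ ν⁻¹ * C₂ := by
    intro s hs x hx
    rw [timeRescale_apply, norm_smul, Real.norm_of_nonneg hinv]
    calc cylRadius x * (ν⁻¹ * ‖u (ν⁻¹ * s) x‖) = ν⁻¹ * (cylRadius x * ‖u (ν⁻¹ * s) x‖) := by ring
      _ ≤ ν⁻¹ * C₂ := mul_le_mul_of_nonneg_left (hC₂ _ (hmaps hs) x hx) hinv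
  obtain ⟨C', hC''⟩ := H hνT h1 hbdd1 haxi1 hC' hrate1 hR₀ hdecay1
  refine ⟨ν * C', fun t ht x => ?_⟩
  have hs : ν * t ∈ Ioo 0 (ν * T) := ⟨mul_pos hν ht.1, mul_lt_mul_of_pos_left ht.2 hν⟩
  have key := hC'' _ hs x
  have e : ν⁻¹ * (ν * t) = t := by field_simp
  rw [timeRescale_apply, e, norm_smul, Real.norm_of_nonneg hinv] at key
  calc cylRadius x * ‖u t x‖ = ν * (cylRadius x * (ν⁻¹ * ‖u t x‖)) := by field_simp
    _ ≤ ν * C' := mul_le_mul_of_nonneg_left key hν.le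

/-- **The main step of Theorem 6.2 from its compactness–Liouville–vertex step** (Steps 2–4 of
the printed proof, arXiv:0709.3599 pp. 12–13, proved; viscosity normalised by
`knss_rMulNorm_bounded_of_unit_viscosity`; `C` enlarged to `max C 1 > 0`). [cite: KochNadirashviliSereginSverak2009, proof of Thm 6.2 (arXiv pp. 12–13)] -/
theorem KNSS2009_typeI_rate_rMulNorm_bounded_of_blowupSequence
    (hd : KNSS2009_typeI_rate_blowupSequence) : KNSS2009_typeI_rate_rMulNorm_bounded := by
  refine knss_rMulNorm_bounded_of_unit_viscosity
    fun T u p hT h hbdd haxi C hC hI C₂ R₀ hR₀ hdecay => ?_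
  exact knss_rMulNorm_bounded_of_blowupSequence_unit hd hT h hbdd haxi hC hI hR₀ hdecay

/-- **KNSS 2009, Theorem 6.2 as vendored, from Theorem 6.1 and Steps 5–6 of its proof.**
`KNSS2009_regularity_typeI_rate` follows from `KNSS2009_regularity_bound_C_over_r`
(Theorem 6.1) and `KNSS2009_typeI_rate_blowupSequence` (compactness of the doubly rescaled
sequence, the planar Liouville theorem with Remark 6.1, and the representation formula at the
vertex), everything else in the printed proof being proved in the tree. [cite: KochNadirashviliSereginSverak2009, Thm 6.2 and its proof (arXiv pp. 12–13)] -/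
theorem KNSS2009_regularity_typeI_rate_of_blowupSequence
    (h61 : KNSS2009_regularity_bound_C_over_r) (hd : KNSS2009_typeI_rate_blowupSequence) :
    KNSS2009_regularity_typeI_rate :=
  KNSS2009_regularity_typeI_rate_of_parts h61
    (KNSS2009_typeI_rate_rMulNorm_bounded_of_blowupSequence hd)

end Viscosity

end Literature.Analysis.FluidPDE

end
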